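/-
Origin: expansion seat `planner-pub-hodgecm-mc-axioms-1-g14-0`, handover #W244 2026-08-20T15:53:55Z md5 313e86797384 (PKG ed8033361acd → 313e86797384; 200 l.; MECHANICAL (iib-R) rewrite v3.1 of the PKG file as it stands (39 token edits; rules R1x1+RX[h₂]x38)) (`HOME/mc/pub-hodgecm-mc-axioms-1-g14/revendor/kit-r55/stage55/HodgeCM/Model/Binders/Gen12CharMem.lean`, md5 313e86797384, 200 lines);
landed by the gen-22 packager (p-g22) in gate run 55 REPLACES the earlier landed copy of `HodgeCM/Model/Binders/Gen12CharMem.lean` (seat copy carried the packager Origin header of an earlier run (stripped)).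
-/
/-
Origin: speedrun cell pub-hodgecm, MODEL-CONSTRUCTION sub-cell, unit pub-hodgecm-mc-binder-1-g7 (BINDER PROVER, gen 7; node
B2-meet, BINDER-OWNERS row 14, clause (hμ) of the see-saw record), seat prover-pub-hodgecm-mc-binder-1-g7-0, 2026-08-19
(″ (adm) re-cut the same day: `SeesawCore` carries the admissibility predicate `adm` of `Gen12Residual.Adm`).
Target in PKG: HodgeCM/Model/Binders/Gen12CharMem.lean (NEW additive leaf; imports kit #7 `Model/Binders/Gen12OfSeesaw` (binder-1-g6,
RUN-36 kit `t36-mcbinder1g6.txt`) and the INSTALLED `Model/ArchTypeReadOff` (period-2-g5, RUN 34); nothing landed imports it).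
KERNEL ONLY: 0 records of published theorems, nothing cited, 0 `def … : Prop`, MODEL-N ±0.
-/
import Summits.HodgeConjecture.HodgeCM.Model.Binders.Gen12OfSeesaw
import Summits.HodgeConjecture.HodgeCM.Model.ArchTypeReadOff

/-!
# (hμ) of `SeesawHyp` IS the literal check N1 for the two lines of the (12) side

`Binders/MeetBridgesSeesaw` splits junction (J-seesaw) of row `gen12` into the hypothesis record
`SeesawHyp hHD hI h₁ h₃ W S μ V c hV = {τ, seesaw (SS), wedge_mem (SS-K), char_mem (hμ)}`.  Its last clause

  (hμ) `∀ χ₀ χ₁, (∀ t_∞, χ₀(cl t_∞) · w₀(t_∞) = 1) → (∀ t_∞, χ₁(cl t_∞) · w₁(t_∞) = 1) →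
          charPair χ₀ χ₁ ∈ allowedChars L (d12Of μ c).m₁ (d12Of μ c).m₂`,

`w_k := ((S V c).P k).w` the (W-wt) weight of line `k` of the adelic side, is NOT a third producer's debt: it is a formal
consequence of the reviewers' literal check **N1** between E's two binders `S` and `μ` for the lines `k = 0, 1` of THIS context,

  (N1)  `((S V c).P k).w = archWeight L (μ c k)`      (`Model/ArchTypeReadOff` §4, period-2-g5),

by `WeilPairData.residualType_iff_hasArchType_neg` (the residual's type condition `χ(cl t_∞)·w(t_∞) = 1` IS
`HasArchType L χ (-m)` for a typed weight `w = archWeight L m`), `SeesawTorus.charPair_mem_allowedChars_iff` and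
`d12Of_m₁ / d12Of_m₂ : (d12Of μ c).m_j = -μ c (j-1)` (`rfl`).  PerL v5 ll. 398–400 / 476 / 481: the type `w = (e_b(Ψ₁), e_b(Ψ₂))_b`
of the characters `χ₁₂` of the (12) side is READ OFF the action of `U(W_{i,b}) = U(1)` on the test vectors — which is what N1 says.

So this leaf (i) proves (hμ) from (N1) at lines `0, 1` (`charMem_of_N1`), and from the END-STATE form of N1 — `w_k` typed and
`μ c k = ((S V c).P k).archType` the read-off exponent (`charMem_of_readOff`); (ii) introduces the CORE see-saw record
`SeesawCore = {τ, seesaw (SS), wedge_mem (SS-K)}` (the two genuine producer debts: (S-restr) `P_eq_restrict`, period-1; the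
`𝒮^κ` clause, K-types lane) with `SeesawCore.toHyp` under (N1); (iii) re-cuts kit #7's headline to
`gen12_of_seesawCore : Gen12Residual → SeesawCore → (N1 at lines 0,1) → ‹E's gen12 verbatim›`.
ROW 14 after this leaf: `gen12` ⟸ RECORD 1 `Gen12Residual {Sat, rep, proj}` ⊕ RECORD 2′ `SeesawCore {τ, (SS), (SS-K)}` ⊕ (N1)₀,₁
— and (N1) is `rfl`-fed at any honest `S` whose weights are DEFINED as `archWeight L (type)` with `μ :=` that type.
Nothing here is a claim of the manuscripts under adjudication.
-/

set_option autoImplicit false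

noncomputable section

open MeasureTheory NumberField
open scoped InnerProductSpace

namespace HodgeCM.Model

open HodgeCM HodgeCM.Universe
open Literature.NumberTheory.Weil1964
open Literature.NumberTheory.Automorphic (piSchwartzBruhat)
open Literature.AlgebraicGeometry.HodgeTheory
open Literature.NumberTheory.Automorphic.PicardCM
open Literature.NumberTheory.Transcendental (Arapura2012_Cor_15_4_6)
open HodgeCM.Model.ThetaSpace HodgeCM.Model.SupplyResidual
open NumberField.SeesawTorus (HasArchType charPair allowedChars charPair_mem_allowedChars_iff)

variable (hHD : exists_isReal_hodgeModel) (hI : hodgePQ_independent_of_hodgeModel)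
  (h₁ : BallQuotientUniformised)  (h₃ : CMAbelianVarietyRealised)
variable (h : Bool) (hA : Arapura2012_Cor_15_4_6)
  (W : ∀ {L : CMField} {ι₁ : L →+* ℂ} (V : HermSpace3 L ι₁) (c : SeesawCtx L), WmInput V c.D)
  (S : ∀ {L : CMField} {ι₁ : L →+* ℂ} (V : HermSpace3 L ι₁) (c : SeesawCtx L), ThetaAdelicSide V c)
  (μ : ∀ {L : CMField}, SeesawCtx L → Fin 4 → InfinitePlace L → ℤ)
variable {L : CMField} {ι₁ : L →+* ℂ} (V : HermSpace3 L ι₁) (c : SeesawCtx L) (hV : IsAnisotropic L V.Hm)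

local notation3 "L⁺" => maximalRealSubfield (L : Type)

/- the ADMISSIBILITY predicate on `K`-type situations (`Gen12Junctions.Adm` / `Gen12Residual.Adm`; at the (Θ-sat) pin: saturated at the
level's compact open and strict) -/
variable (adm : ∀ (Γ : Level V) (k : Fin 4),
    KTypeSituation ((pinX hHD hI h₁ h₃ S V c hV).P k) ((pinX hHD hI h₁ h₃ S V c hV).ιinf Γ) ((pinX hHD hI h₁ h₃ S V c hV).Δ Γ) (pinX hHD hI h₁ h₃ S V c hV).κ₁ (pinX hHD hI h₁ h₃ S V c hV).τ₁ → Prop)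

/-! ## 1. (hμ) from N1 at the two lines -/

/-- **(hμ) from the literal check N1 at lines `0, 1`.**  If the (W-wt) weights of the two lines of the (12) side are the
characters `archWeight L (μ c 0)`, `archWeight L (μ c 1)` (N1), then every pair of residual characters `χ₀, χ₁` — type
condition `χ_k(cl t_∞) · w_k(t_∞) = 1` — has `charPair χ₀ χ₁` in the (12) side's index set `allowedChars L (-μ c 0) (-μ c 1)`. -/
theorem charMem_of_N1 (h0 : ((S V c).P 0).w = ⇑(archWeight L (μ c 0))) (h1 : ((S V c).P 1).w = ⇑(archWeight L (μ c 1)))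
    (χ₀ χ₁ : PontryaginDual (relNormOneIdeles L⁺ L ⧸ relNormOneRat L⁺ L))
    (hχ₀ : ∀ t : Literature.NumberTheory.Automorphic.relNormOneInfUnits L⁺ L,
      ((χ₀ (QuotientGroup.mk (Literature.NumberTheory.Automorphic.relNormOneInfToIdeles L⁺ L t)) : Circle) : ℂ) * ((S V c).P 0).w t = 1)
    (hχ₁ : ∀ t : Literature.NumberTheory.Automorphic.relNormOneInfUnits L⁺ L,
      ((χ₁ (QuotientGroup.mk (Literature.NumberTheory.Automorphic.relNormOneInfToIdeles L⁺ L t)) : Circle) : ℂ) * ((S V c).P 1).w t = 1) :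
    charPair χ₀ χ₁ ∈ allowedChars (L : Type) (d12Of μ c).m₁ (d12Of μ c).m₂ := by
  rw [charPair_mem_allowedChars_iff, d12Of_m₁, d12Of_m₂]
  exact ⟨(((S V c).P 0).residualType_iff_hasArchType_neg h0 χ₀).1 hχ₀,
    (((S V c).P 1).residualType_iff_hasArchType_neg h1 χ₁).1 hχ₁⟩

/-- **(hμ) in END-STATE form**: if the weights of lines `0, 1` are TYPED (`∃ m, w_k = archWeight L m` — (W-wt) for a line
spanned by one vector, `ArchTypeReadOff` §2) and the exponent binder is the READ-OFF type, `μ c k = ((S V c).P k).archType`,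
then (hμ). -/
theorem charMem_of_readOff (h0 : ∃ m : InfinitePlace L → ℤ, ⇑(archWeight L m) = ((S V c).P 0).w)
    (h1 : ∃ m : InfinitePlace L → ℤ, ⇑(archWeight L m) = ((S V c).P 1).w)
    (hμ0 : μ c 0 = ((S V c).P 0).archType) (hμ1 : μ c 1 = ((S V c).P 1).archType)
    (χ₀ χ₁ : PontryaginDual (relNormOneIdeles L⁺ L ⧸ relNormOneRat L⁺ L))
    (hχ₀ : ∀ t : Literature.NumberTheory.Automorphic.relNormOneInfUnits L⁺ L,
      ((χ₀ (QuotientGroup.mk (Literature.NumberTheory.Automorphic.relNormOneInfToIdeles L⁺ L t)) : Circle) : ℂ) * ((S V c).P 0).w t = 1)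
    (hχ₁ : ∀ t : Literature.NumberTheory.Automorphic.relNormOneInfUnits L⁺ L,
      ((χ₁ (QuotientGroup.mk (Literature.NumberTheory.Automorphic.relNormOneInfToIdeles L⁺ L t)) : Circle) : ℂ) * ((S V c).P 1).w t = 1) :
    charPair χ₀ χ₁ ∈ allowedChars (L : Type) (d12Of μ c).m₁ (d12Of μ c).m₂ :=
  charMem_of_N1 S μ V c (hμ0 ▸ (archWeight_archTypeOf h0).symm) (hμ1 ▸ (archWeight_archTypeOf h1).symm) χ₀ χ₁ hχ₀ hχ₁

/-! ## 2. The core see-saw record `{τ, (SS), (SS-K)}` and the constructor of `SeesawHyp` under N1 -/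

/-- **The CORE see-saw hypotheses at the context `(V, c)`**: `SeesawHyp` WITHOUT its clause (hμ) — the pairing `τ`, the restriction
identity (SS) at Θ-values and the `𝒮^κ` clause (SS-K), verbatim.  A HYPOTHESIS record — nothing here is asserted. -/
structure SeesawCore where
  /-- the pure tensor of two small test functions, read in the W-block's Schwartz–Bruhat space -/
  τ : piSchwartzBruhat L⁺ (Fin 3) → piSchwartzBruhat L⁺ (Fin 3) → piSchwartzBruhat (W V c).F (W V c).ι
  /-- (SS) the restriction identity at Θ-values along `eV` / `eW ∘ jT₁₂` (PerL Lemma «seesaw»; (S-restr) `P_eq_restrict`) -/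
  seesaw : ∀ (g : ↥(Adelic.regimeSubgroup L V.Hm)) (t : SeesawTorus L⁺ L) (φ₁ φ₂ : piSchwartzBruhat L⁺ (Fin 3)),
    thetaDistLM (W V c).F (W V c).ι
        ((((W V c).ρ ((W V c).eV (g : ↥(Adelic.adelicUnitaryGroup L V.Hm)), (W V c).eW (c.D.jT₁₂ t))) :
          Module.End ℂ (piSchwartzBruhat (W V c).F (W V c).ι)) (τ φ₁ φ₂)) =
      thetaDistLM L⁺ (Fin 3) (((S V c).P 0).ω (g, SeesawTorus.fst L⁺ L t) φ₁) *
        thetaDistLM L⁺ (Fin 3) (((S V c).P 1).ω (g, SeesawTorus.snd L⁺ L t) φ₂)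
  /-- (SS-K) the wedge test function of two `K`-type-pinned pairs of ADMISSIBLE situations lies in `𝒮^κ` -/
  wedge_mem : ∀ (Γ : Level V)
    (Sit₀ : KTypeSituation ((pinX hHD hI h₁ h₃ S V c hV).P 0) ((pinX hHD hI h₁ h₃ S V c hV).ιinf Γ)
      ((pinX hHD hI h₁ h₃ S V c hV).Δ Γ) (pinX hHD hI h₁ h₃ S V c hV).κ₁ (pinX hHD hI h₁ h₃ S V c hV).τ₁)
    (Sit₁ : KTypeSituation ((pinX hHD hI h₁ h₃ S V c hV).P 1) ((pinX hHD hI h₁ h₃ S V c hV).ιinf Γ)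
      ((pinX hHD hI h₁ h₃ S V c hV).Δ Γ) (pinX hHD hI h₁ h₃ S V c hV).κ₁ (pinX hHD hI h₁ h₃ S V c hV).τ₁),
    adm Γ 0 Sit₀ → adm Γ 1 Sit₁ → ∀ j₀ ∈ Sit₀.𝓙, ∀ j₁ ∈ Sit₁.𝓙,
      τ (j₀.1 (Sit₀.ι (LinearMap.proj 0))) (j₁.1 (Sit₁.ι (LinearMap.proj 1))) -
        τ (j₀.1 (Sit₀.ι (LinearMap.proj 1))) (j₁.1 (Sit₁.ι (LinearMap.proj 0))) ∈ (W V c).SK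

namespace SeesawCore

variable {hHD hI h₁ h₃ W S μ V c hV adm}

/-- **`SeesawCore` + (N1 at lines 0, 1) ⇒ `SeesawHyp`.** -/
def toHyp (K : SeesawCore hHD hI h₁ h₃ W S V c hV adm)
    (h0 : ((S V c).P 0).w = ⇑(archWeight L (μ c 0))) (h1 : ((S V c).P 1).w = ⇑(archWeight L (μ c 1))) :
    SeesawHyp hHD hI h₁ h₃ W S μ V c hV adm where
  τ := K.τ
  seesaw := K.seesaw
  wedge_mem := K.wedge_mem
  char_mem χ₀ χ₁ hχ₀ hχ₁ := charMem_of_N1 S μ V c h0 h1 χ₀ χ₁ hχ₀ hχ₁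

/-- The same from the END-STATE form of N1 (typed weights, read-off exponents). -/
def toHypOfReadOff (K : SeesawCore hHD hI h₁ h₃ W S V c hV adm)
    (h0 : ∃ m : InfinitePlace L → ℤ, ⇑(archWeight L m) = ((S V c).P 0).w)
    (h1 : ∃ m : InfinitePlace L → ℤ, ⇑(archWeight L m) = ((S V c).P 1).w)
    (hμ0 : μ c 0 = ((S V c).P 0).archType) (hμ1 : μ c 1 = ((S V c).P 1).archType) :
    SeesawHyp hHD hI h₁ h₃ W S μ V c hV adm :=
  K.toHyp (hμ0 ▸ (archWeight_archTypeOf h0).symm) (hμ1 ▸ (archWeight_archTypeOf h1).symm)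

/-- Conversely `SeesawHyp` forgets to `SeesawCore`. -/
def _root_.HodgeCM.Model.SeesawHyp.toCore (H : SeesawHyp hHD hI h₁ h₃ W S μ V c hV adm) :
    SeesawCore hHD hI h₁ h₃ W S V c hV adm :=
  ⟨H.τ, H.seesaw, H.wedge_mem⟩

end SeesawCore

/-! ## 3. Row `gen12` from the residual junctions, the CORE see-saw record and N1 at lines 0, 1 -/

/-- **E's binder `gen12` (verbatim, quantified form) from RECORD 1 `Gen12Residual`, RECORD 2′ `SeesawCore` and the literal
check N1 at the two lines of the (12) side** — kit #7 `gen12_of_seesaw` with (hμ) discharged by `charMem_of_N1`. -/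
theorem gen12_of_seesawCore
    (R : ∀ {L : CMField} {ι₁ : L →+* ℂ} (V : HermSpace3 L ι₁) (c : SeesawCtx L) (hV : IsAnisotropic L V.Hm),
      (pinT hHD hI h₁ h₃ h hA W S μ).GoodCtx ι₁ c → Module.finrank ℚ c.K = 6 →
        Gen12Residual hHD hI h₁ h₃ h hA W S μ V c hV)
    (K : ∀ {L : CMField} {ι₁ : L →+* ℂ} (V : HermSpace3 L ι₁) (c : SeesawCtx L) (hV : IsAnisotropic L V.Hm)
      (hc : (pinT hHD hI h₁ h₃ h hA W S μ).GoodCtx ι₁ c) (hK : Module.finrank ℚ c.K = 6),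
        SeesawCore hHD hI h₁ h₃ W S V c hV (R V c hV hc hK).Adm)
    (hN1 : ∀ {L : CMField} {ι₁ : L →+* ℂ} (V : HermSpace3 L ι₁) (c : SeesawCtx L) (k : Fin 4), k = 0 ∨ k = 1 →
      ((S V c).P k).w = ⇑(archWeight L (μ c k)))
    {L : CMField} {ι₁ : L →+* ℂ} (V : HermSpace3 L ι₁) (c : SeesawCtx L)
    (hc : (pinT hHD hI h₁ h₃ h hA W S μ).GoodCtx ι₁ c) (hK : Module.finrank ℚ c.K = 6) :
    Nonempty ((pinT hHD hI h₁ h₃ h hA W S μ).Gen12FunBridge V c) :=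
  gen12_of_seesaw hHD hI h₁ h₃ h hA W S μ R
    (fun V c hV hc hK => (K V c hV hc hK).toHyp (hN1 V c 0 (Or.inl rfl)) (hN1 V c 1 (Or.inr rfl))) V c hc hK

/-- **The same in END-STATE form**: typed weights at lines `0, 1` and the exponent binder READ OFF the adelic side there. -/
theorem gen12_of_seesawCore_readOff
    (R : ∀ {L : CMField} {ι₁ : L →+* ℂ} (V : HermSpace3 L ι₁) (c : SeesawCtx L) (hV : IsAnisotropic L V.Hm),
      (pinT hHD hI h₁ h₃ h hA W S μ).GoodCtx ι₁ c → Module.finrank ℚ c.K = 6 →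
        Gen12Residual hHD hI h₁ h₃ h hA W S μ V c hV)
    (K : ∀ {L : CMField} {ι₁ : L →+* ℂ} (V : HermSpace3 L ι₁) (c : SeesawCtx L) (hV : IsAnisotropic L V.Hm)
      (hc : (pinT hHD hI h₁ h₃ h hA W S μ).GoodCtx ι₁ c) (hK : Module.finrank ℚ c.K = 6),
        SeesawCore hHD hI h₁ h₃ W S V c hV (R V c hV hc hK).Adm)
    (hw : ∀ {L : CMField} {ι₁ : L →+* ℂ} (V : HermSpace3 L ι₁) (c : SeesawCtx L) (k : Fin 4), k = 0 ∨ k = 1 →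
      ∃ m : InfinitePlace L → ℤ, ⇑(archWeight L m) = ((S V c).P k).w)
    (hμ : ∀ {L : CMField} {ι₁ : L →+* ℂ} (V : HermSpace3 L ι₁) (c : SeesawCtx L) (k : Fin 4), k = 0 ∨ k = 1 →
      μ c k = ((S V c).P k).archType)
    {L : CMField} {ι₁ : L →+* ℂ} (V : HermSpace3 L ι₁) (c : SeesawCtx L)
    (hc : (pinT hHD hI h₁ h₃ h hA W S μ).GoodCtx ι₁ c) (hK : Module.finrank ℚ c.K = 6) :
    Nonempty ((pinT hHD hI h₁ h₃ h hA W S μ).Gen12FunBridge V c) :=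
  gen12_of_seesaw hHD hI h₁ h₃ h hA W S μ R
    (fun V c hV hc hK => (K V c hV hc hK).toHypOfReadOff (hw V c 0 (Or.inl rfl)) (hw V c 1 (Or.inr rfl))
      (hμ V c 0 (Or.inl rfl)) (hμ V c 1 (Or.inr rfl))) V c hc hK

end HodgeCM.Model

end
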